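import Literature.Geometry.Lorentzian.Geodesic
import Literature.Geometry.Lorentzian.LeviCivitaCurvature
import Literature.Geometry.Riemannian.ConstantCurvature
import HarnessLib

/-!
# Geodesics, completeness and constant curvature of an arbitrary Levi-Civita connection

Companion of `LeviCivitaCurvature.lean` (curvature of any Levi-Civita connection) for the notions of
`Geodesic.lean`.  Several statements of the tree (the hyperbolicity clause of
`Literature.Topology.FourManifolds.exists_fiveTori_hyperbolic_complement_sphereFour`,
`…exists_toriComplement_homeomorphic_sphereFour`, `…Davis1985_exists_closed_hyperbolic_four`, and the
`SmoothPoincare4` cruxes that consume them) quantify over *every* covariant derivative `cov` with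
`g.IsLeviCivita cov` — torsion-free and `g`-compatible — because Mathlib's `CovariantDerivative` is
unconstrained on non-differentiable sections, so "the" Levi-Civita connection is unique only on
differentiable fields (`IsLeviCivita.eq_leviCivita_holds`, O'Neill 1983, Ch. 3, Thm. 3.11).  This
file shows, with no new facts, that nothing in `Geodesic.lean` distinguishes such a `cov` from
`g.leviCivita`:

* `IsLeviCivita.covariantDerivAlongFrame_eq`, `IsLeviCivita.covariantDerivAlong_eq` — the induced
  covariant derivative `DW/dt` along any curve (O'Neill 1983, Ch. 3, Prop. 3.18, local-frame
  formula) is the same for `cov` and for `g.leviCivita`: the formula evaluates the connection only on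
  the local frame sections `e.localFrame b i`, which are smooth at the point;
* `IsLeviCivita.isGeodesicOn_iff`, `isGeodesic_iff`, `isMaximalGeodesicOn_iff`,
  `isGeodesicallyComplete_iff` — hence the same geodesics, maximal geodesics and the same
  completeness (O'Neill 1983, Ch. 3, Def. 3.19 and p. 68);
* `forall_isLeviCivita_isGeodesicallyComplete_iff` — "every Levi-Civita connection of `g` is
  geodesically complete" iff `g.leviCivita` is;
* `hasConstantSectionalCurvature_iff_leviCivita` — for `n ≥ 2`, `g.HasConstantSectionalCurvature c`
  (all Levi-Civita connections, `ConstantCurvature.lean`) iff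
  `g.HasConstantSectionalCurvatureWith g.leviCivita c` (by `IsLeviCivita.curvature_eq_riemann`);
* `hasConstantSectionalCurvature_and_forall_isGeodesicallyComplete_iff` — the two together: the
  "complete metric of constant sectional curvature `c`" clause of the statements above reduces to a
  statement about `g.leviCivita` alone.

## References

* [ONeill1983] B. O'Neill, *Semi-Riemannian geometry with applications to relativity*, Academic
  Press 1983, Ch. 3: Thm. 3.11 (pp. 60–61, uniqueness of the Levi-Civita connection), Prop. 3.18
  (p. 65, induced covariant derivative on a curve), Def. 3.19 ff. and p. 68 (geodesics,
  completeness), Lemma 3.35 (curvature).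
* [Lee2018] J. M. Lee, *Introduction to Riemannian Manifolds*, 2nd ed., Prop. 8.36.
-/

noncomputable section

open Bundle Set
open scoped Manifold ContDiff Topology

namespace Literature.Geometry.Lorentzian

namespace PseudoRiemannianMetric

variable {E : Type*} [NormedAddCommGroup E] [NormedSpace ℝ E] {H : Type*} [TopologicalSpace H]
  {I : ModelWithCorners ℝ E H} {M : Type*} [TopologicalSpace M] [ChartedSpace H M]
  [IsManifold I ∞ M] {n : ℕ∞ω} [Fact (1 ≤ n)] [FiniteDimensional ℝ E] [CompleteSpace E]
  {g : PseudoRiemannianMetric I n E (TangentSpace I : M → Type _)} [g.HasLeviCivita]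
  {cov : CovariantDerivative I E (TangentSpace I : M → Type _)}

/-! ### The covariant derivative along a curve sees the connection only on smooth frame fields -/

/-- **The local-frame formula for `DW/dt` does not distinguish Levi-Civita connections.** For a
torsion-free `g`-compatible `cov`, a trivialisation `e ∋ γ t₀` and a basis `b`,
`∑ᵢ (cⁱ)' sᵢ + ∑ᵢ cⁱ ∇_{γ'} sᵢ` is the same whether `∇ = cov` or `∇ = g.leviCivita`: the frame
sections `sᵢ = e.localFrame b i` are smooth at `γ t₀` (`contMDiffAt_localFrame_of_mem`), where the two
connections agree by the uniqueness half of the fundamental lemma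
(`IsLeviCivita.eq_leviCivita_holds`). O'Neill 1983, Ch. 3, Thm. 3.11 with Prop. 3.18.
[cite: ONeill1983, Ch. 3, Thm. 3.11 and Prop. 3.18] -/
theorem IsLeviCivita.covariantDerivAlongFrame_eq (h : g.IsLeviCivita cov) {ι : Type*} [Fintype ι]
    (e : Trivialization E (TotalSpace.proj : TangentBundle I M → M)) [MemTrivializationAtlas e]
    (b : Module.Basis ι ℝ E) {γ : ℝ → M} (W : Π t : ℝ, TangentSpace I (γ t)) {t₀ : ℝ}
    (he : γ t₀ ∈ e.baseSet) :
    covariantDerivAlongFrame cov e b γ W t₀ = covariantDerivAlongFrame g.leviCivita e b γ W t₀ := by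
  have hs : ∀ i, cov (e.localFrame b i) (γ t₀) = g.leviCivita (e.localFrame b i) (γ t₀) := fun i ↦
    IsLeviCivita.eq_leviCivita_holds h
      ((contMDiffAt_localFrame_of_mem 1 e b i he).mdifferentiableAt one_ne_zero)
  simp only [covariantDerivAlongFrame, hs]

/-- **The covariant derivative along a curve is the same for every Levi-Civita connection of `g`**:
`DW/dt` computed with a torsion-free `g`-compatible `cov` equals `DW/dt` computed with
`g.leviCivita`, for every curve `γ`, every field `W` along it and every parameter `t₀` (no
differentiability hypotheses: both sides are the same local-frame expression).
O'Neill 1983, Ch. 3, Thm. 3.11 with Prop. 3.18. [cite: ONeill1983, Ch. 3, Thm. 3.11 and Prop. 3.18] -/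
theorem IsLeviCivita.covariantDerivAlong_eq (h : g.IsLeviCivita cov) (γ : ℝ → M)
    (W : Π t : ℝ, TangentSpace I (γ t)) (t₀ : ℝ) :
    covariantDerivAlong cov γ W t₀ = covariantDerivAlong g.leviCivita γ W t₀ := by
  rw [covariantDerivAlong_def, covariantDerivAlong_def]
  exact h.covariantDerivAlongFrame_eq _ _ W (FiberBundle.mem_baseSet_trivializationAt' (γ t₀))

/-! ### Geodesics and completeness -/

/-- **Every Levi-Civita connection of `g` has the same geodesics** (on any parameter set): the
geodesic condition `D(γ')/dt = 0` of `Geodesic.lean` for a torsion-free `g`-compatible `cov` is the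
one for `g.leviCivita`. O'Neill 1983, Ch. 3, Def. 3.19 with Thm. 3.11.
[cite: ONeill1983, Ch. 3, Def. 3.19 and Thm. 3.11] -/
theorem IsLeviCivita.isGeodesicOn_iff (h : g.IsLeviCivita cov) {γ : ℝ → M} {s : Set ℝ} :
    IsGeodesicOn cov γ s ↔ IsGeodesicOn g.leviCivita γ s := by
  simp only [IsGeodesicOn, h.covariantDerivAlong_eq]

/-- Every Levi-Civita connection of `g` has the same geodesics defined on `ℝ`.
O'Neill 1983, Ch. 3, Def. 3.19 with Thm. 3.11. [cite: ONeill1983, Ch. 3, Def. 3.19 and Thm. 3.11] -/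
theorem IsLeviCivita.isGeodesic_iff (h : g.IsLeviCivita cov) {γ : ℝ → M} :
    IsGeodesic cov γ ↔ IsGeodesic g.leviCivita γ :=
  h.isGeodesicOn_iff

/-- Every Levi-Civita connection of `g` has the same maximal (inextendible) geodesics.
O'Neill 1983, Ch. 3, p. 68 with Thm. 3.11. [cite: ONeill1983, Ch. 3, p. 68 and Thm. 3.11] -/
theorem IsLeviCivita.isMaximalGeodesicOn_iff (h : g.IsLeviCivita cov) {γ : ℝ → M} {s : Set ℝ} :
    IsMaximalGeodesicOn cov γ s ↔ IsMaximalGeodesicOn g.leviCivita γ s := by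
  simp only [IsMaximalGeodesicOn, h.isGeodesicOn_iff]

/-- **Geodesic completeness does not depend on the choice of Levi-Civita connection**: a
torsion-free `g`-compatible `cov` is geodesically complete iff `g.leviCivita` is.
O'Neill 1983, Ch. 3, p. 68 (completeness) with Thm. 3.11. [cite: ONeill1983, Ch. 3, p. 68 and Thm. 3.11] -/
theorem IsLeviCivita.isGeodesicallyComplete_iff (h : g.IsLeviCivita cov) :
    IsGeodesicallyComplete cov ↔ IsGeodesicallyComplete g.leviCivita := by
  simp only [IsGeodesicallyComplete, h.isGeodesic_iff]

variable (g) in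
/-- **"Every Levi-Civita connection of `g` is geodesically complete" iff `g.leviCivita` is** — the
form in which completeness is phrased by statements that avoid naming `g.leviCivita`
(e.g. `Literature.Topology.FourManifolds.exists_fiveTori_hyperbolic_complement_sphereFour`); the
forward direction is the existence half of the fundamental lemma (`isLeviCivita_leviCivita_holds`).
O'Neill 1983, Ch. 3, Thm. 3.11 and p. 68. [cite: ONeill1983, Ch. 3, Thm. 3.11 and p. 68] -/
theorem forall_isLeviCivita_isGeodesicallyComplete_iff :
    (∀ cov : CovariantDerivative I E (TangentSpace I : M → Type _), g.IsLeviCivita cov →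
        IsGeodesicallyComplete cov) ↔ IsGeodesicallyComplete g.leviCivita :=
  ⟨fun h ↦ h _ (isLeviCivita_leviCivita_holds (g := g)),
    fun h _ hcov ↦ hcov.isGeodesicallyComplete_iff.2 h⟩

/-! ### Constant sectional curvature -/

variable (g) in
/-- **Constant sectional curvature may be checked on `g.leviCivita` alone** (`C^n` metric, `n ≥ 2`):
`g.HasConstantSectionalCurvature c` — the identity `Rm = c (g ∧ g)` of Lee, Prop. 8.36 for every
Levi-Civita connection of `g` (`ConstantCurvature.lean`) — iff it holds for `g.leviCivita`, since the
curvature tensor of any Levi-Civita connection is `g.riemann` (`IsLeviCivita.curvature_eq_riemann`,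
O'Neill 1983, Thm. 3.11 with Lemma 3.35). [cite: Lee2018, Prop. 8.36] -/
theorem hasConstantSectionalCurvature_iff_leviCivita (hn : 2 ≤ n) {c : ℝ} :
    g.HasConstantSectionalCurvature c ↔ g.HasConstantSectionalCurvatureWith g.leviCivita c := by
  refine ⟨fun h ↦ h _ (isLeviCivita_leviCivita_holds (g := g)), fun h cov hcov x X Y Z W ↦ ?_⟩
  have hx := h x X Y Z W
  simp only [curvatureForm] at hx ⊢
  rw [hcov.curvature_eq_riemann hn x]
  exact hx

variable (g) in
/-- **The "complete metric of constant sectional curvature `c`" clause, reduced to `g.leviCivita`**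
(`n ≥ 2`): `g.HasConstantSectionalCurvature c ∧ ∀ cov, g.IsLeviCivita cov → IsGeodesicallyComplete cov`
— the hyperbolicity clause (with `c = -1`) of
`Literature.Topology.FourManifolds.exists_fiveTori_hyperbolic_complement_sphereFour` and its siblings —
holds iff `g.HasConstantSectionalCurvatureWith g.leviCivita c ∧ IsGeodesicallyComplete g.leviCivita`.
O'Neill 1983, Ch. 3, Thm. 3.11, Lemma 3.35, p. 68; Lee, Prop. 8.36. [cite: ONeill1983, Ch. 3, Thm. 3.11] -/
theorem hasConstantSectionalCurvature_and_forall_isGeodesicallyComplete_iff (hn : 2 ≤ n) {c : ℝ} :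
    (g.HasConstantSectionalCurvature c ∧
        ∀ cov : CovariantDerivative I E (TangentSpace I : M → Type _), g.IsLeviCivita cov →
          IsGeodesicallyComplete cov) ↔
      g.HasConstantSectionalCurvatureWith g.leviCivita c ∧ IsGeodesicallyComplete g.leviCivita :=
  and_congr (g.hasConstantSectionalCurvature_iff_leviCivita hn)
    (g.forall_isLeviCivita_isGeodesicallyComplete_iff)

/-! ### From one complete constant-curvature Levi-Civita connection to the clause -/

omit [g.HasLeviCivita] in
/-- **One Levi-Civita connection of constant curvature suffices**: if some torsion-free
`g`-compatible `cov` satisfies `Rm = c (g ∧ g)` (`HasConstantSectionalCurvatureWith`), then `g` has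
constant sectional curvature `c` in the all-connections sense (`C^n` metric, `n ≥ 2`) — the curvature
tensor of every Levi-Civita connection is `g.riemann` (`IsLeviCivita.curvature_eq_riemann`). This is
the form a construction uses: exhibit an explicit connection (e.g. by Christoffel symbols), check it
is Levi-Civita and compute its curvature once. O'Neill 1983, Ch. 3, Thm. 3.11 and Lemma 3.35; Lee,
Prop. 8.36. [cite: Lee2018, Prop. 8.36] -/
theorem IsLeviCivita.hasConstantSectionalCurvature (h : g.IsLeviCivita cov) (hn : 2 ≤ n) {c : ℝ}
    (hc : g.HasConstantSectionalCurvatureWith cov c) : g.HasConstantSectionalCurvature c := by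
  haveI := g.hasLeviCivita
  refine (g.hasConstantSectionalCurvature_iff_leviCivita hn).2 fun x X Y Z W ↦ ?_
  have hx := hc x X Y Z W
  simp only [curvatureForm] at hx ⊢
  rw [h.curvature_eq_riemann hn x] at hx
  exact hx

omit [g.HasLeviCivita] in
/-- **One complete Levi-Civita connection suffices**: if some torsion-free `g`-compatible `cov` is
geodesically complete, then every Levi-Civita connection of `g` is (they have the same geodesics,
`IsLeviCivita.isGeodesic_iff`). O'Neill 1983, Ch. 3, Thm. 3.11 and p. 68.
[cite: ONeill1983, Ch. 3, Thm. 3.11 and p. 68] -/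
theorem IsLeviCivita.forall_isGeodesicallyComplete (h : g.IsLeviCivita cov)
    (hc : IsGeodesicallyComplete cov) :
    ∀ cov' : CovariantDerivative I E (TangentSpace I : M → Type _), g.IsLeviCivita cov' →
      IsGeodesicallyComplete cov' := by
  haveI := g.hasLeviCivita
  exact (g.forall_isLeviCivita_isGeodesicallyComplete_iff).2 (h.isGeodesicallyComplete_iff.1 hc)

end PseudoRiemannianMetric

end Literature.Geometry.Lorentzian

end
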